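import Summits.CriticalPhenomena.PercolationContinuityZ3.Theses.PercOpenSupercrit
import Summits.CriticalPhenomena.PercolationContinuityZ3.Theorems.PercNearOneGluingNoHeavyLowerTailCSHTheoremOne
import Literature.Probability.Percolation.BernoulliPercolationProofs
import Literature.Probability.Percolation.CriticalTwoArmsPersistence
import HarnessLib

/-!
# `PercOpenSupercrit.GoodBoxSchemeGivesThesis` (stmt-CriticalPhenomena-14586) — SETTLED after continuity

Item `stmt-CriticalPhenomena-14586` of route `CriticalPhenomena/PercOpenSupercrit` (support): glue `… → PercOpenSupercritThesis`.

The conclusion `PercOpenSupercritThesis` (openness of the supercritical set) is proved outright from p205010 (as in the lane's closing file of item 0680: `{θ > 0} = Ioi p_c`); the hypotheses are not used.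

builds on p205010 (kernel theorem, internal audit signed; external expert review pending) — USED (`CSH.percolationContinuityZ3_holds`).  RSW3 lane, lead gen 28 (prover-prim-rsw3-lead-g28-0):
'after continuity — the ledger harvest'.
References: G. Kozma, N. Nitzan (2024), Thm. 6 / Conj. 3 [KozmaNitzan2024]; G. Grimmett, *Percolation* (1999), §8 [GrimmettPercolation1999].
-/

noncomputable section

namespace Summit.CriticalPhenomena.PercolationContinuityZ3.Theorems

namespace PercOpenSupercritGoodBoxSchemeGivesThesis

open MeasureTheory Literature.Probability.Percolation Literature.Probability.LatticeModels

/-- **`PercOpenSupercrit.GoodBoxSchemeGivesThesis` (stmt-CriticalPhenomena-14586), settled.**  conclusion proved outright: `{θ > 0} = Ioi (p_c)` by p205010.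
[cite: KozmaNitzan2024, Thm. 6 with Conj. 3 (p. 15)] -/
theorem goodBoxSchemeGivesThesis_proof : Summit.CriticalPhenomena.PercolationContinuityZ3.Theses.PercOpenSupercrit.GoodBoxSchemeGivesThesis := by
  intro _ _ _ _
  show IsOpen {p : unitInterval | 0 < theta (zdGraph 3) 0 p}
  have hset : {p : unitInterval | 0 < theta (zdGraph 3) 0 p} = Set.Ioi (criticalProbI 3) := by
    ext p
    simp only [Set.mem_setOf_eq, Set.mem_Ioi]
    constructor
    · intro hp
      have hle := KestenZhang.criticalProb_le_of_theta_pos_zd hp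
      rcases hle.eq_or_lt with heq | hlt
      · exfalso
        have hp' : p = criticalProbI 3 := Subtype.ext (by rw [coe_criticalProbI]; exact heq.symm)
        rw [hp', show theta (zdGraph 3) (0 : Site 3) (criticalProbI 3) = 0 from CSH.percolationContinuityZ3_holds] at hp
        exact lt_irrefl _ hp
      · exact Subtype.coe_lt_coe.1 (by rw [coe_criticalProbI]; exact hlt)
    · intro hp
      exact theta_pos_of_criticalProb_lt_holds (zdGraph 3) (0 : Site 3) p
        (by rw [← coe_criticalProbI]; exact Subtype.coe_lt_coe.2 hp)
  rw [hset]
  exact isOpen_Ioi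

end PercOpenSupercritGoodBoxSchemeGivesThesis

end Summit.CriticalPhenomena.PercolationContinuityZ3.Theorems

end
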